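import Literature.Probability.RandomPlanarGeometry.CritPercSLEProofs
import Literature.Probability.RandomPlanarGeometry.ChordalCurveFamilyProofs
import HarnessLib

/-!
# Stopped-curve range events: measurability, and their reading on a time-compactified image

Topic `Probability/RandomPlanarGeometry`; theorems only (no new definitions, no named facts).
Curve-space glue for the *splitting form of locality* (target independence,
`ChordalFamily.IsTargetIndependent`, Lawler–Schramm–Werner (2001), Cor. 2.3), whose events are of
the form `CurveClass.stopAt F ⁻¹' T`: the curve STOPPED at its first hitting of a closed set `F`.

* `Curve.exists_stopAt_apply_eq_iff` — the trace of the initial segment `γ.stopAt F` is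
  `{γ s | s ≤ hitParam F γ}`; `CurveClass.mk_mem_stopAt_preimage_hitsBefore_empty_iff` — hence the
  class of `γ` stopped on `F` has met `A` (event `stopAt F ⁻¹' hitsBefore A ∅`) iff `γ s ∈ A` for
  some `s ≤ hitParam F γ` (representative independence `CurveClass.stopAt_mk_holds`);
* `CurveClass.stopAt_preimage_hitsBefore_empty_eq`,
  `CurveClass.measurableSet_stopAt_preimage_hitsBefore_empty` — **the stopped-curve range event is
  Borel** for closed `A`, `F`: it is `{source ∈ A ∩ F} ∪ ({source ∉ F} ∩ ⋂ₙ hitsBefore A_{1/(n+1)} F)`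
  with `A_ε` the closed `ε`-neighbourhood of `A` (crossing events are Borel,
  `CurveClass.measurableSet_hitsBefore_holds`; the transfer between representatives is
  `Curve.exists_mem_forall_lt_notMem_of_dist_eq_zero` and a compactness argument on `[0, 1]`);
* `mk_mem_stopAt_preimage_hitsBefore_iff` — for the time-compactified image `c` of a path
  `γ : ℝ≥0 → ℂ` under `Ψ` (`IsCompactifiedImage`, the form in which chordal SLE curves are given,
  `IsSLECurve`) and sets `A`, `F` pulling back along `γ` to closed sets `SA`, `SF`: the class of
  `c` stopped on `F` has met `A` iff `γ` hits `SA` at a finite time not later than its first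
  hitting of `SF`, or never hits `SF` and ends in `A`.

Companion of `CritPercSLEProofs` (`mk_mem_hitsBefore_iff_firstHit_lt`, the unstopped crossing
event). References: G. F. Lawler, O. Schramm, W. Werner, Acta Math. 187 (2001), §2–3 (Cor. 2.3);
M. Aizenman, A. Burchard, Duke Math. J. 99 (1999), §2.1 (the curve space and its crossing events).
-/

noncomputable section

open Set Filter Topology MeasureTheory Complex Metric
open UpperHalfPlane (upperHalfPlaneSet)
open scoped NNReal ENNReal unitInterval

namespace Literature.Probability.RandomPlanarGeometry

/-! ### The trace of a stopped curve -/

namespace Curve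

variable {E : Type*} [TopologicalSpace E]

/-- **The trace of the initial segment.** A point is on the curve `γ` stopped at its first hitting
of `F` iff it is `γ s` for a parameter `s` at most the hitting parameter. [folklore] -/
theorem exists_stopAt_apply_eq_iff (F : Set E) (γ : Curve E) (x : E) :
    (∃ s, γ.stopAt F s = x) ↔ ∃ s : I, (s : ℝ) ≤ γ.hitParam F ∧ γ s = x := by
  have hτ := γ.hitParam_mem_Icc F
  constructor
  · rintro ⟨s, rfl⟩
    have hmem : γ.hitParam F * s ∈ Icc (0 : ℝ) 1 :=
      ⟨mul_nonneg hτ.1 s.2.1, (mul_le_of_le_one_right hτ.1 s.2.2).trans hτ.2⟩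
    refine ⟨⟨γ.hitParam F * s, hmem⟩, mul_le_of_le_one_right hτ.1 s.2.2, ?_⟩
    rw [stopAt_apply, projIcc_of_mem _ hmem]
  · rintro ⟨s, hs, rfl⟩
    rcases hτ.1.eq_or_lt with h0 | hpos
    · refine ⟨0, ?_⟩
      have hs0 : (s : ℝ) = 0 := le_antisymm (h0 ▸ hs) s.2.1
      have : s = 0 := Subtype.ext hs0
      rw [stopAt_apply, this]
      simp [projIcc_left]
    · have hmem : (s : ℝ) / γ.hitParam F ∈ Icc (0 : ℝ) 1 :=
        ⟨div_nonneg s.2.1 hτ.1, (div_le_one hpos).2 hs⟩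
      refine ⟨⟨(s : ℝ) / γ.hitParam F, hmem⟩, ?_⟩
      rw [stopAt_apply]
      have : γ.hitParam F * ((s : ℝ) / γ.hitParam F) = s := mul_div_cancel₀ _ hpos.ne'
      simp only [this]
      rw [projIcc_val zero_le_one s]

/-- If the curve avoids `F` at every parameter `< 1`, its hitting parameter is `1`. [folklore] -/
theorem hitParam_eq_one_of_forall_lt_one_notMem {F : Set E} {γ : Curve E}
    (h : ∀ s : I, (s : ℝ) < 1 → γ s ∉ F) : γ.hitParam F = 1 := by
  refine le_antisymm (γ.hitParam_mem_Icc F).2 (le_csInf ⟨1, γ.one_mem_hitSet F⟩ ?_)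
  rintro x (⟨hxI, hxF⟩ | hx1)
  · by_contra hx
    exact h ⟨x, hxI⟩ (lt_of_not_ge hx) hxF
  · rw [mem_singleton_iff.1 hx1]

end Curve

/-! ### The stopped-curve range event on curve classes -/

namespace CurveClass

variable {E : Type*} [MetricSpace E]

/-- **Reading of the stopped-curve range event on a representative**: for closed `F`, the class of
`γ` stopped on `F` has met `A` iff `γ s ∈ A` for some parameter `s` at most the hitting parameter
of `F`. [folklore] -/
theorem mk_mem_stopAt_preimage_hitsBefore_empty_iff {A F : Set E} (hF : IsClosed F) (γ : Curve E) :
    mk γ ∈ stopAt F ⁻¹' hitsBefore A (∅ : Set E) ↔ ∃ s : I, (s : ℝ) ≤ γ.hitParam F ∧ γ s ∈ A := by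
  rw [mem_preimage, stopAt_mk_holds F hF γ, hitsBefore_empty_right, mem_compl_iff,
    mk_mem_rangeSubset]
  simp only [mem_compl_iff, not_forall, not_not]
  constructor
  · rintro ⟨t, ht⟩
    obtain ⟨s, hs, hst⟩ := (Curve.exists_stopAt_apply_eq_iff F γ _).1 ⟨t, rfl⟩
    exact ⟨s, hs, hst ▸ ht⟩
  · rintro ⟨s, hs, hsA⟩
    obtain ⟨t, ht⟩ := (Curve.exists_stopAt_apply_eq_iff F γ (γ s)).2 ⟨s, hs, rfl⟩
    exact ⟨t, ht ▸ hsA⟩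

/-- A parameter before which (strictly) the curve avoids `F` is at most the hitting parameter of
the closed set `F`. [folklore] -/
theorem coe_le_hitParam_of_forall_lt_notMem {F : Set E} (hF : IsClosed F) {γ : Curve E} {s : I}
    (h : ∀ r < s, γ r ∉ F) : (s : ℝ) ≤ γ.hitParam F := by
  by_contra hlt
  rw [not_le] at hlt
  rcases Curve.hitParam_mem_hitSet hF γ with ⟨hτI, hτF⟩ | hτ1
  · exact h ⟨γ.hitParam F, hτI⟩ (Subtype.coe_lt_coe.1 hlt) hτF
  · have h1 : γ.hitParam F = 1 := mem_singleton_iff.1 hτ1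
    have h2 : (s : ℝ) ≤ 1 := s.2.2
    rw [h1] at hlt
    exact absurd h2 (not_le.2 hlt)

/-- **The stopped-curve range event through crossing events.** For closed `A`, `F`: the class of a
curve stopped on `F` has met `A` iff either the curve starts in `A ∩ F`, or it starts off `F` and,
for every `n`, hits the closed `1/(n+1)`-neighbourhood of `A` (strictly) before `F`. [folklore] -/
theorem stopAt_preimage_hitsBefore_empty_eq {A F : Set E} (hA : IsClosed A) (hF : IsClosed F) :
    stopAt F ⁻¹' hitsBefore A (∅ : Set E) =
      source ⁻¹' (A ∩ F) ∪
        (source ⁻¹' Fᶜ ∩ ⋂ n : ℕ, hitsBefore (cthickening (1 / ((n : ℝ) + 1)) A) F) := by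
  ext x
  obtain ⟨γ, rfl⟩ := surjective_mk x
  rw [mk_mem_stopAt_preimage_hitsBefore_empty_iff hF]
  simp only [mem_union, mem_inter_iff, mem_preimage, source_mk, Curve.source_def, mem_compl_iff,
    mem_iInter]
  by_cases h0 : γ 0 ∈ F
  · -- the curve starts on `F`: it is stopped at once
    have hτ : γ.hitParam F = 0 :=
      le_antisymm (by simpa using Curve.hitParam_le (F := F) (t := 0) h0) (γ.hitParam_mem_Icc F).1
    constructor
    · rintro ⟨s, hs, hsA⟩
      rw [hτ] at hs
      have : s = 0 := Subtype.ext (le_antisymm hs s.2.1)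
      rw [this] at hsA
      exact Or.inl ⟨hsA, h0⟩
    · rintro (⟨hA0, -⟩ | ⟨hn, -⟩)
      · exact ⟨0, by rw [hτ]; exact le_rfl, hA0⟩
      · exact absurd h0 hn
  · constructor
    · rintro ⟨s, hs, hsA⟩
      refine Or.inr ⟨h0, fun n ↦ ?_⟩
      have hεpos : (0 : ℝ) < 1 / ((n : ℝ) + 1) := by positivity
      by_cases hsF : (s : ℝ) < γ.hitParam F ∨ γ s ∉ F
      · -- no contact with `F` up to and including `s`
        refine mk_mem_hitsBefore (t := s) (self_subset_cthickening A hsA) fun r hr hrF ↦ ?_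
        rcases hr.lt_or_eq with hlt | heq
        · exact Curve.notMem_of_lt_hitParam (lt_of_lt_of_le (Subtype.coe_lt_coe.2 hlt) hs) hrF
        · rw [heq] at hrF
          rcases hsF with hlt' | hnot
          · exact Curve.notMem_of_lt_hitParam hlt' hrF
          · exact hnot hrF
      · -- `s` is the hitting parameter and a contact point: back off a little
        rw [not_or, not_lt, not_not] at hsF
        have hsτ : (s : ℝ) = γ.hitParam F := le_antisymm hs hsF.1
        have hs0 : (0 : ℝ) < s := by
          refine lt_of_le_of_ne s.2.1 fun h ↦ h0 ?_
          have : s = 0 := Subtype.ext h.symm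
          rw [← this]
          exact hsF.2
        obtain ⟨δ, hδ, hδε⟩ := Metric.continuous_iff.1 γ.continuous s _ hεpos
        set r : ℝ := (s : ℝ) - min (δ / 2) ((s : ℝ) / 2) with hr
        have hmin : 0 < min (δ / 2) ((s : ℝ) / 2) := lt_min (by linarith) (by linarith)
        have hrI : r ∈ Icc (0 : ℝ) 1 := by
          refine ⟨?_, ?_⟩
          · have := min_le_right (δ / 2) ((s : ℝ) / 2)
            rw [hr]; linarith
          · rw [hr]; linarith [s.2.2]
        have hrs : (⟨r, hrI⟩ : I) < s := Subtype.coe_lt_coe.1 (by show r < s; rw [hr]; linarith)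
        have hdist : dist (⟨r, hrI⟩ : I) s < δ := by
          rw [Subtype.dist_eq, Real.dist_eq, show ((⟨r, hrI⟩ : I) : ℝ) = r from rfl, hr,
            show (s : ℝ) - min (δ / 2) ((s : ℝ) / 2) - s = -min (δ / 2) ((s : ℝ) / 2) by ring,
            abs_neg, abs_of_pos hmin]
          linarith [min_le_left (δ / 2) ((s : ℝ) / 2)]
        refine mk_mem_hitsBefore (t := ⟨r, hrI⟩) ?_ fun r' hr' hr'F ↦ ?_
        · exact mem_cthickening_of_dist_le _ (γ s) _ _ hsA (hδε _ hdist).le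
        · exact Curve.notMem_of_lt_hitParam
            (hsτ ▸ Subtype.coe_lt_coe.2 (lt_of_le_of_lt hr' hrs)) hr'F
    · rintro (⟨-, hF0⟩ | ⟨-, hall⟩)
      · exact absurd hF0 h0
      · -- a witness for each `n`, transported to `γ`, and a subsequential limit
        have hwit : ∀ n : ℕ, ∃ s : I, γ s ∈ cthickening (1 / ((n : ℝ) + 1)) A ∧ ∀ r < s, γ r ∉ F := by
          intro n
          obtain ⟨γ', ⟨t, htA, htF⟩, hmk⟩ := hall n
          exact Curve.exists_mem_forall_lt_notMem_of_dist_eq_zero hF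
            (by rw [dist_comm]; exact mk_eq_mk_iff_dist_eq_zero.1 hmk) htA htF
        choose s hsA hsF using hwit
        obtain ⟨s₀, φ, hφ, hlim⟩ := CompactSpace.tendsto_subseq s
        refine ⟨s₀, ?_, ?_⟩
        · have hlim' : Tendsto (fun k ↦ ((s (φ k) : I) : ℝ)) atTop (𝓝 (s₀ : ℝ)) :=
            (continuous_subtype_val.tendsto s₀).comp hlim
          exact le_of_tendsto' hlim' fun k ↦ coe_le_hitParam_of_forall_lt_notMem hF (hsF (φ k))
        · -- `infEdist (γ s₀) A = 0`
          rw [← hA.closure_eq, Metric.mem_closure_iff_infEDist_zero]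
          have hcont : Tendsto (fun k ↦ Metric.infEDist (γ (s (φ k))) A) atTop
              (𝓝 (Metric.infEDist (γ s₀) A)) :=
            ((Metric.continuous_infEDist.comp γ.continuous).tendsto s₀).comp hlim
          have hbound : ∀ k, Metric.infEDist (γ (s (φ k))) A ≤ ENNReal.ofReal (1 / ((φ k : ℝ) + 1)) :=
            fun k ↦ mem_cthickening_iff.1 (hsA (φ k))
          have hzero : Tendsto (fun k ↦ ENNReal.ofReal (1 / ((φ k : ℝ) + 1))) atTop (𝓝 0) := by
            rw [← ENNReal.ofReal_zero]
            refine ENNReal.tendsto_ofReal ?_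
            have h1 : Tendsto (fun k ↦ (φ k : ℝ) + 1) atTop atTop :=
              tendsto_atTop_add_const_right _ _
                (tendsto_natCast_atTop_atTop.comp hφ.tendsto_atTop)
            exact h1.const_div_atTop 1 |>.congr fun k ↦ by simp [one_div]
          exact le_antisymm (le_of_tendsto_of_tendsto hcont hzero
            (Eventually.of_forall hbound)) bot_le

/-- **The stopped-curve range event is Borel**: for closed `A`, `F`,
`stopAt F ⁻¹' hitsBefore A ∅` is measurable (through `stopAt_preimage_hitsBefore_empty_eq` and
the measurability of crossing events `measurableSet_hitsBefore_holds`). [folklore] -/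
theorem measurableSet_stopAt_preimage_hitsBefore_empty {A F : Set E} (hA : IsClosed A)
    (hF : IsClosed F) : MeasurableSet (stopAt F ⁻¹' hitsBefore A (∅ : Set E)) := by
  rw [stopAt_preimage_hitsBefore_empty_eq hA hF]
  exact ((hA.inter hF).preimage continuous_source).measurableSet.union
    ((hF.isOpen_compl.preimage continuous_source).measurableSet.inter
      (MeasurableSet.iInter fun n ↦ measurableSet_hitsBefore_holds isClosed_cthickening hF))

end CurveClass

/-! ### The stopped-curve range event of a time-compactified image -/

/-- Strict order version of `rayParam_le_rayParam_iff`. [folklore] -/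
theorem rayParam_lt_rayParam_iff {s t : I} (hs : (s : ℝ) < 1) (ht : (t : ℝ) < 1) :
    rayParam s < rayParam t ↔ s < t := by
  rw [← not_le, rayParam_le_rayParam_iff ht hs, not_le]

/-- **Deterministic reading of "the curve stopped on `F` has met `A`".** Let `c` be the
time-compactified image of the path `γ` under `Ψ` with end point `b`, and let `A`, `F` be sets
(`F` closed) whose `Ψ`-preimages along `γ` are the closed sets `SA`, `SF`. Then the class of `c`
stopped at its first hitting of `F` meets `A` (event `stopAt F ⁻¹' hitsBefore A ∅`) iff either `γ`
hits `SA` at a finite time not later than its first hitting of `SF`, or `γ` never hits `SF` and the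
end point `b` lies in `A`. [folklore] -/
theorem mk_mem_stopAt_preimage_hitsBefore_iff {Ψ : ℂ → ℂ} {γ : ℝ≥0 → ℂ} {b : ℂ} {c : Curve ℂ}
    {A F SA SF : Set ℂ} (hF : IsClosed F) (hSA : IsClosed SA) (hSF : IsClosed SF)
    (hγ : Continuous γ) (hΨA : ∀ t, Ψ (γ t) ∈ A ↔ γ t ∈ SA) (hΨF : ∀ t, Ψ (γ t) ∈ F ↔ γ t ∈ SF)
    (hc : IsCompactifiedImage Ψ γ b c) :
    CurveClass.mk c ∈ CurveClass.stopAt F ⁻¹' CurveClass.hitsBefore A (∅ : Set ℂ) ↔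
      (firstHit γ SA ≤ firstHit γ SF ∧ firstHit γ SA < ⊤) ∨ (firstHit γ SF = ⊤ ∧ b ∈ A) := by
  rw [CurveClass.mk_mem_stopAt_preimage_hitsBefore_empty_iff hF]
  -- the image curve at parameters `< 1`
  have hcF : ∀ s : I, (s : ℝ) < 1 → (c s ∈ F ↔ γ (rayParam s) ∈ SF) := fun s hs ↦ by
    rw [hc.1 s hs, hΨF]
  have hcA : ∀ s : I, (s : ℝ) < 1 → (c s ∈ A ↔ γ (rayParam s) ∈ SA) := fun s hs ↦ by
    rw [hc.1 s hs, hΨA]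
  constructor
  · rintro ⟨s, hsτ, hsA⟩
    rcases lt_or_eq_of_le s.2.2 with hs1 | hs1
    · left
      have hA' : γ (rayParam s) ∈ SA := (hcA s hs1).1 hsA
      have hσA : firstHit γ SA ≤ rayParam s := firstHit_le hA'
      refine ⟨?_, hσA.trans_lt (WithTop.coe_lt_top _)⟩
      by_contra hlt
      rw [not_le] at hlt
      obtain ⟨t₁, ht₁, hγt₁⟩ := exists_firstHit_eq_coe hγ hSF hlt.ne_top
      obtain ⟨s₁, hs₁1, hs₁t⟩ := exists_rayParam_eq t₁
      have hc₁ : c s₁ ∈ F := by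
        rw [hcF s₁ hs₁1, hs₁t]
        exact hγt₁
      have ht₁s : (t₁ : WithTop ℝ≥0) < rayParam s := ht₁ ▸ hlt.trans_le hσA
      have hs₁s : s₁ < s := by
        rw [← rayParam_lt_rayParam_iff hs₁1 hs1, hs₁t]
        exact_mod_cast ht₁s
      exact Curve.notMem_of_lt_hitParam (lt_of_lt_of_le (Subtype.coe_lt_coe.2 hs₁s) hsτ) hc₁
    · have hs : s = 1 := Subtype.ext hs1
      rw [hs, hc.2] at hsA
      by_cases hσF : firstHit γ SF = ⊤
      · exact Or.inr ⟨hσF, hsA⟩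
      · exfalso
        obtain ⟨t₁, ht₁, hγt₁⟩ := exists_firstHit_eq_coe hγ hSF hσF
        obtain ⟨s₁, hs₁1, hs₁t⟩ := exists_rayParam_eq t₁
        have hc₁ : c s₁ ∈ F := by
          rw [hcF s₁ hs₁1, hs₁t]
          exact hγt₁
        have h1 : c.hitParam F ≤ s₁ := Curve.hitParam_le hc₁
        have h2 : (s : ℝ) ≤ c.hitParam F := hsτ
        rw [hs1] at h2
        linarith
  · rintro (⟨hle, hfin⟩ | ⟨hσF, hbA⟩)
    · obtain ⟨t₀, ht₀, hγt₀⟩ := exists_firstHit_eq_coe hγ hSA hfin.ne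
      obtain ⟨s₀, hs₀1, hs₀t⟩ := exists_rayParam_eq t₀
      refine ⟨s₀, ?_, by rw [hcA s₀ hs₀1, hs₀t]; exact hγt₀⟩
      by_contra hlt
      rw [not_le] at hlt
      rcases Curve.hitParam_mem_hitSet hF c with ⟨hτI, hτF⟩ | hτ1
      · have hτ1 : c.hitParam F < 1 := hlt.trans_le s₀.2.2
        have hγF : γ (rayParam ⟨c.hitParam F, hτI⟩) ∈ SF := (hcF ⟨_, hτI⟩ hτ1).1 hτF
        have h1 : firstHit γ SF ≤ rayParam ⟨c.hitParam F, hτI⟩ := firstHit_le hγF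
        have h2 : rayParam ⟨c.hitParam F, hτI⟩ < rayParam s₀ :=
          (rayParam_lt_rayParam_iff hτ1 hs₀1).2 (Subtype.coe_lt_coe.1 hlt)
        have : firstHit γ SF < firstHit γ SA := by
          rw [ht₀, ← hs₀t]
          exact h1.trans_lt (by exact_mod_cast h2)
        exact absurd hle (not_le.2 this)
      · have h1 : c.hitParam F = 1 := mem_singleton_iff.1 hτ1
        have h2 : (s₀ : ℝ) ≤ 1 := s₀.2.2
        rw [h1] at hlt
        exact absurd h2 (not_le.2 hlt)
    · refine ⟨1, ?_, by rw [hc.2]; exact hbA⟩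
      rw [Curve.hitParam_eq_one_of_forall_lt_one_notMem]
      · exact le_rfl
      · intro s hs hsF
        have := firstHit_le ((hcF s hs).1 hsF)
        rw [hσF, top_le_iff] at this
        exact WithTop.coe_ne_top this

end Literature.Probability.RandomPlanarGeometry
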